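import Literature.NumberTheory.EllipticCurves.ModFiveImageZywinaG9
import Literature.NumberTheory.GaloisRepresentations.SerreCartanSubgroupsGL2Fp
import HarnessLib

/-!
# Route `ErratumRoadFive` (rung K2), crux `NonSurjCorner` (item stmt-BirchSwinnertonDyer-19065), TOOL file:
# Zywina's `G₉ ⊂ GL₂(𝔽₅)` — the explicit normal form, the order-`5` certificate, and the lemma
# "a subgroup of `GL₂(𝔽₅)` of order prime to `5` containing a split half-Cartan subgroup lies in a
# conjugate of `G₉`" (cell `bsd-stepL`, seat `bsd-stepL-corner5-p2` g5, WIDTH-LEVER lane B;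
# `--supports stmt-BirchSwinnertonDyer-19065 --as helper`)

THEOREMS ONLY (no definition, no named fact); pure finite group theory, consumed by the sequel
`ErratumRoadFiveNonSurjCornerFiveJLine.lean` (every corner pair at `p = 5` lies on Zywina's `J₉`-line).
`G₉` is DEFINED in `Literature/NumberTheory/EllipticCurves/ModFiveImageZywinaG9.lean` (this lane, p569408)
as the subgroup of `GL₂(𝔽₅)` generated by Zywina's four printed matrices `(2 0; 0 1)`, `(1 0; 0 2)`,
`(0 −1; 1 0)`, `(1 1; 1 −1)` (arXiv:1508.07660 §1.3: "the unique maximal subgroup of `GL₂(𝔽₅)` which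
contains `N_s(5)`", index `5`, image `𝔖₄` in `PGL₂(𝔽₅) ≅ 𝔖₅`), next to a computable quadruple model
`Quad` of `M₂(𝔽₅)`. This file proves, with two `decide` computations over the `625` quadruples:

* §1 the model computes matrix products (`Quad.ofMatrix_mul`, `…_pow`, injectivity);
* §2 `Quad.cert_of_not_inG9` — for every invertible `x` failing the explicit membership test `inG9`
  (`x`, `m₁x` or `m₂x` monomial) one of the words `x·x`, `x·h·x·h`, `x·x·h²`, `x·h·x·h³`
  (`h = (1 0; 0 2)`) has `w⁴ ≠ 1 = w²⁰`, i.e. `w⁴` has order `5`; `Quad.exists_normalForm_of_inG9` —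
  every invertible `x` passing the test is one of `96` normal forms
  `c_k · (0 4; 1 0)^ε · (2 0; 0 1)^i · (1 0; 0 2)^j`;
* §3 the generators as elements of `GL₂(𝔽₅)`, the coset representatives `c_k` and the normal forms
  lie in `G9`; hence `mem_G9_of_inG9` (the test implies membership; so `#G₉ ≥ 96`, `N_s(5) ≤ G₉`);
* §4 **`le_G9_of_halfDiagonalSubgroup_le`** / **`le_map_G9_of_halfSplitCartan_le`**: a subgroup
  `H ≤ GL₂(𝔽₅)` with `5 ∤ #H` containing `{diag(1, u)}` (resp. `P (1 0; 0 *) P⁻¹`, Serre 1972 §2.1 a))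
  is contained in `G₉` (resp. `P G₉ P⁻¹`) — an `x ∈ H` outside `G₉` would put an element of order
  `5` in `H`. (Conceptually: in `PGL₂(𝔽₅) ≅ 𝔖₅` the torus `{diag(1, u)}` is generated by a `4`-cycle,
  `G₉` is the stabiliser of its fixed point, and `⟨h, x⟩` is transitive on the five letters as soon
  as `x` moves that point; the finite certificate replaces the isomorphism with `𝔖₅`.)

HONEST FRAMING: a tool file; nothing here is about elliptic curves, no stub or census number moves (T7).
References: [Zywina2015] D. Zywina, arXiv:1508.07660 (2015), §1.3; [Serre1972] J.-P. Serre, Invent.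
Math. 15 (1972), §2.1 a) (split half-Cartan subgroups), §2.6 (the octahedral case).
-/

set_option linter.dupNamespace false -- `Summit.BirchSwinnertonDyer.BirchSwinnertonDyer` (summit = problem), tree-wide

noncomputable section

open scoped Classical

namespace Summit.BirchSwinnertonDyer.BirchSwinnertonDyer.Theorems.ZywinaG9

open Matrix Literature.NumberTheory.GaloisRepresentations
  Literature.NumberTheory.GaloisRepresentations.Serre1972
  Literature.NumberTheory.EllipticCurves Literature.NumberTheory.EllipticCurves.Zywina2015G9

namespace Quad

open Literature.NumberTheory.EllipticCurves.Zywina2015G9.Quad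

/-! ### §1. The quadruple model computes matrix products -/

/-- `ofMatrix` is injective (a `2 × 2` matrix is its four entries). [folklore] -/
theorem ofMatrix_injective : Function.Injective ofMatrix := by
  intro A B h
  simp only [ofMatrix, Prod.mk.injEq] at h
  obtain ⟨h00, h01, h10, h11⟩ := h
  rw [Matrix.eta_fin_two A, Matrix.eta_fin_two B, h00, h01, h10, h11]

/-- `ofMatrix (A * B) = ofMatrix A · ofMatrix B`. [folklore] -/
theorem ofMatrix_mul (A B : Matrix (Fin 2) (Fin 2) (ZMod 5)) : ofMatrix (A * B) = mul (ofMatrix A) (ofMatrix B) := by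
  simp only [ofMatrix, mul, Matrix.mul_apply, Fin.sum_univ_two]

/-- `ofMatrix 1 = one`. [folklore] -/
theorem ofMatrix_one : ofMatrix (1 : Matrix (Fin 2) (Fin 2) (ZMod 5)) = one := by
  decide +kernel

/-- `ofMatrix (A ^ n) = npow n (ofMatrix A)`. [folklore] -/
theorem ofMatrix_pow (A : Matrix (Fin 2) (Fin 2) (ZMod 5)) (n : ℕ) : ofMatrix (A ^ n) = npow n (ofMatrix A) := by
  induction n with
  | zero => rw [pow_zero, ofMatrix_one]; rfl
  | succ n ih =>
    rw [pow_succ, ofMatrix_mul, ih]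
    exact (Function.iterate_succ_apply' (fun y => mul y (ofMatrix A)) n one).symm

/-- `det (ofMatrix A) = A.det`. [folklore] -/
theorem det_ofMatrix (A : Matrix (Fin 2) (Fin 2) (ZMod 5)) : det (ofMatrix A) = A.det := by
  rw [Matrix.det_fin_two]; rfl

/-- `ofMatrix` on `GL₂(𝔽₅)` is multiplicative. [folklore] -/
theorem ofMatrix_coe_mul (x y : GL (Fin 2) (ZMod 5)) :
    ofMatrix ((x * y : GL (Fin 2) (ZMod 5)) : Matrix (Fin 2) (Fin 2) (ZMod 5)) = mul (ofMatrix (x : Matrix (Fin 2) (Fin 2) (ZMod 5))) (ofMatrix (y : Matrix (Fin 2) (Fin 2) (ZMod 5))) := by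
  rw [Units.val_mul, ofMatrix_mul]

/-- `ofMatrix` on `GL₂(𝔽₅)` maps powers to `npow`. [folklore] -/
theorem ofMatrix_coe_pow (x : GL (Fin 2) (ZMod 5)) (n : ℕ) :
    ofMatrix ((x ^ n : GL (Fin 2) (ZMod 5)) : Matrix (Fin 2) (Fin 2) (ZMod 5)) = npow n (ofMatrix (x : Matrix (Fin 2) (Fin 2) (ZMod 5))) := by
  rw [Units.val_pow_eq_pow_val, ofMatrix_pow]

/-- Two elements of `GL₂(𝔽₅)` with the same quadruple of entries are equal. [folklore] -/
theorem _root_.Summit.BirchSwinnertonDyer.BirchSwinnertonDyer.Theorems.ZywinaG9.eq_of_ofMatrix_eq {x y : GL (Fin 2) (ZMod 5)}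
    (hxy : ofMatrix (x : Matrix (Fin 2) (Fin 2) (ZMod 5)) = ofMatrix (y : Matrix (Fin 2) (Fin 2) (ZMod 5))) : x = y :=
  Units.ext (ofMatrix_injective hxy)

/-! ### §2. The two finite computations (`decide`, `625` quadruples each) -/

/-- **Order-`5` certificate.** For every invertible quadruple `x ∉ G₉` (explicit test `inG9`) one of
the four words `x·x`, `x·h·x·h`, `x·x·h²`, `x·h·x·h³` (`h = (1 0; 0 2)`) satisfies `w⁴ ≠ 1`, `w²⁰ = 1`.
(In `PGL₂(𝔽₅) ≅ 𝔖₅`: `h` is a `4`-cycle, `G₉` the stabiliser of its fixed point, and `⟨h, x⟩` is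
transitive on `5` letters as soon as `x` moves that point.) Checked by `decide`. [folklore] -/
theorem cert_of_not_inG9 : ∀ a b c d : ZMod 5,
    det (a, b, c, d) ≠ 0 → inG9 (a, b, c, d) = false → ∃ i : Fin 4, cert (word (a, b, c, d) i) = true := by
  decide +kernel

/-- **Normal form.** Every invertible quadruple passing the test `inG9` is one of the `96` normal forms
`c_k · (0 4; 1 0)^ε · (2 0; 0 1)^i · (1 0; 0 2)^j`. Checked by `decide`. [folklore] -/
theorem exists_normalForm_of_inG9 : ∀ a b c d : ZMod 5,
    det (a, b, c, d) ≠ 0 → inG9 (a, b, c, d) = true →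
      ∃ k : Fin 3, ∃ ε : Fin 2, ∃ i j : Fin 4, ((a, b, c, d) : Quad) = normalForm k ε i j := by
  decide +kernel

/-- `cert_of_not_inG9` for a quadruple variable. [folklore] -/
theorem cert_of_not_inG9' (x : Quad) (hdet : det x ≠ 0) (hx : inG9 x = false) :
    ∃ i : Fin 4, cert (word x i) = true := by
  obtain ⟨a, b, c, d⟩ := x
  exact cert_of_not_inG9 a b c d hdet hx

/-- `exists_normalForm_of_inG9` for a quadruple variable. [folklore] -/
theorem exists_normalForm_of_inG9' (x : Quad) (hdet : det x ≠ 0) (hx : inG9 x = true) :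
    ∃ k : Fin 3, ∃ ε : Fin 2, ∃ i j : Fin 4, x = normalForm k ε i j := by
  obtain ⟨a, b, c, d⟩ := x
  exact exists_normalForm_of_inG9 a b c d hdet hx

/-- Unfolding of the certificate: `cert w` means `npow 4 w ≠ one ∧ npow 20 w = one`. [folklore] -/
theorem cert_iff (w : Quad) : cert w = true ↔ npow 4 w ≠ one ∧ npow 20 w = one := by
  simp [cert]

end Quad

/-! ### §3. The generators, the coset representatives and the normal forms inside `G9` -/

/-- An invertible matrix whose entries are one of Zywina's four printed quadruples lies in `G₉`
(definition of `G9` as the subgroup they generate). [cite: Zywina2015, §1.3 (definition of G₉)] -/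
theorem mem_G9_of_ofMatrix_mem {g : GL (Fin 2) (ZMod 5)} (hg : Quad.ofMatrix ((g : GL (Fin 2) (ZMod 5)) : Matrix (Fin 2) (Fin 2) (ZMod 5)) ∈ generatorQuads) :
    g ∈ G9 :=
  Subgroup.subset_closure hg

/-- **Zywina's four generators as elements of `GL₂(𝔽₅)`**: there are `gA, gB, gC, gD ∈ G₉` with entries
`(2 0; 0 1)`, `(1 0; 0 2)`, `(0 4; 1 0) = (0 −1; 1 0)`, `(1 1; 1 4) = (1 1; 1 −1)` (each printed matrix is
invertible: inverses `(3 0; 0 1)`, `(1 0; 0 3)`, `(0 1; 4 0)`, `(3 3; 3 2)`).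
[cite: Zywina2015, §1.3 (definition of G₉) (arXiv:1508.07660 p. 4)] -/
theorem exists_generators :
    ∃ gA gB gC gD : GL (Fin 2) (ZMod 5), (gA ∈ G9 ∧ gB ∈ G9 ∧ gC ∈ G9 ∧ gD ∈ G9) ∧
      Quad.ofMatrix ((gA : GL (Fin 2) (ZMod 5)) : Matrix (Fin 2) (Fin 2) (ZMod 5)) = (2, 0, 0, 1) ∧ Quad.ofMatrix ((gB : GL (Fin 2) (ZMod 5)) : Matrix (Fin 2) (Fin 2) (ZMod 5)) = (1, 0, 0, 2) ∧
      Quad.ofMatrix ((gC : GL (Fin 2) (ZMod 5)) : Matrix (Fin 2) (Fin 2) (ZMod 5)) = (0, 4, 1, 0) ∧ Quad.ofMatrix ((gD : GL (Fin 2) (ZMod 5)) : Matrix (Fin 2) (Fin 2) (ZMod 5)) = (1, 1, 1, 4) := by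
  let gA : GL (Fin 2) (ZMod 5) := ⟨!![2, 0; 0, 1], !![3, 0; 0, 1],
    by rw [Matrix.mul_fin_two, Matrix.one_fin_two]; decide +kernel,
    by rw [Matrix.mul_fin_two, Matrix.one_fin_two]; decide +kernel⟩
  let gB : GL (Fin 2) (ZMod 5) := ⟨!![1, 0; 0, 2], !![1, 0; 0, 3],
    by rw [Matrix.mul_fin_two, Matrix.one_fin_two]; decide +kernel,
    by rw [Matrix.mul_fin_two, Matrix.one_fin_two]; decide +kernel⟩
  let gC : GL (Fin 2) (ZMod 5) := ⟨!![0, 4; 1, 0], !![0, 1; 4, 0],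
    by rw [Matrix.mul_fin_two, Matrix.one_fin_two]; decide +kernel,
    by rw [Matrix.mul_fin_two, Matrix.one_fin_two]; decide +kernel⟩
  let gD : GL (Fin 2) (ZMod 5) := ⟨!![1, 1; 1, 4], !![3, 3; 3, 2],
    by rw [Matrix.mul_fin_two, Matrix.one_fin_two]; decide +kernel,
    by rw [Matrix.mul_fin_two, Matrix.one_fin_two]; decide +kernel⟩
  have hA : Quad.ofMatrix ((gA : GL (Fin 2) (ZMod 5)) : Matrix (Fin 2) (Fin 2) (ZMod 5)) = (2, 0, 0, 1) := by decide +kernel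
  have hB : Quad.ofMatrix ((gB : GL (Fin 2) (ZMod 5)) : Matrix (Fin 2) (Fin 2) (ZMod 5)) = (1, 0, 0, 2) := by decide +kernel
  have hC : Quad.ofMatrix ((gC : GL (Fin 2) (ZMod 5)) : Matrix (Fin 2) (Fin 2) (ZMod 5)) = (0, 4, 1, 0) := by decide +kernel
  have hD : Quad.ofMatrix ((gD : GL (Fin 2) (ZMod 5)) : Matrix (Fin 2) (Fin 2) (ZMod 5)) = (1, 1, 1, 4) := by decide +kernel
  refine ⟨gA, gB, gC, gD, ⟨?_, ?_, ?_, ?_⟩, hA, hB, hC, hD⟩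
  · exact mem_G9_of_ofMatrix_mem (by rw [hA]; simp [generatorQuads])
  · exact mem_G9_of_ofMatrix_mem (by rw [hB]; simp [generatorQuads])
  · exact mem_G9_of_ofMatrix_mem (by rw [hC, generatorQuads]; decide +kernel)
  · exact mem_G9_of_ofMatrix_mem (by rw [hD, generatorQuads]; decide +kernel)

/-- The coset representatives `1`, `m₁⁻¹ = gD·gA³·gB³ (= gD⁻¹, as gD² = 2)`, `m₂⁻¹ = gB³·gD·gA³·gB³` are
elements of `G₉` with the quadruples `cosetRep k`. [folklore] -/
theorem exists_cosetRep_mem (k : Fin 3) :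
    ∃ c ∈ G9, Quad.ofMatrix ((c : GL (Fin 2) (ZMod 5)) : Matrix (Fin 2) (Fin 2) (ZMod 5)) = Quad.cosetRep k := by
  obtain ⟨gA, gB, gC, gD, ⟨hAm, hBm, hCm, hDm⟩, hA, hB, hC, hD⟩ := exists_generators
  fin_cases k
  · exact ⟨1, G9.one_mem, Quad.ofMatrix_one⟩
  · refine ⟨gD * gA ^ 3 * gB ^ 3, G9.mul_mem (G9.mul_mem hDm (G9.pow_mem hAm 3)) (G9.pow_mem hBm 3), ?_⟩
    simp only [Quad.ofMatrix_coe_mul, Quad.ofMatrix_coe_pow, hA, hB, hD]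
    decide +kernel
  · refine ⟨gB ^ 3 * gD * gA ^ 3 * gB ^ 3, G9.mul_mem (G9.mul_mem (G9.mul_mem (G9.pow_mem hBm 3) hDm)
      (G9.pow_mem hAm 3)) (G9.pow_mem hBm 3), ?_⟩
    simp only [Quad.ofMatrix_coe_mul, Quad.ofMatrix_coe_pow, hA, hB, hD]
    decide +kernel

section Field

variable [Fact (Nat.Prime 5)]

/-- The determinant of an element of `GL₂(𝔽₅)` is non-zero, in the quadruple model. [folklore] -/
theorem det_ofMatrix_ne_zero (x : GL (Fin 2) (ZMod 5)) : Quad.det (Quad.ofMatrix (x : Matrix (Fin 2) (Fin 2) (ZMod 5))) ≠ 0 := by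
  rw [Quad.det_ofMatrix]; exact Matrix.GeneralLinearGroup.det_ne_zero x

/-- **Every element of `GL₂(𝔽₅)` passing the explicit test `inG9` lies in `G₉`** (it is a word in
Zywina's generators: the normal form). [cite: Zywina2015, §1.3 (definition of G₉)] -/
theorem mem_G9_of_inG9 (x : GL (Fin 2) (ZMod 5)) (hx : Quad.inG9 (Quad.ofMatrix (x : Matrix (Fin 2) (Fin 2) (ZMod 5))) = true) : x ∈ G9 := by
  obtain ⟨k, ε, i, j, hnf⟩ := Quad.exists_normalForm_of_inG9' _ (det_ofMatrix_ne_zero x) hx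
  obtain ⟨c, hc, hcq⟩ := exists_cosetRep_mem k
  obtain ⟨gA, gB, gC, gD, ⟨hAm, hBm, hCm, -⟩, hA, hB, hC, -⟩ := exists_generators
  have hxe : x = c * gC ^ (ε : ℕ) * gA ^ (i : ℕ) * gB ^ (j : ℕ) := by
    apply eq_of_ofMatrix_eq
    rw [Quad.ofMatrix_coe_mul, Quad.ofMatrix_coe_mul, Quad.ofMatrix_coe_mul, Quad.ofMatrix_coe_pow,
      Quad.ofMatrix_coe_pow, Quad.ofMatrix_coe_pow, hcq, hA, hB, hC]
    exact hnf
  rw [hxe]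
  exact G9.mul_mem (G9.mul_mem (G9.mul_mem hc (G9.pow_mem hCm _)) (G9.pow_mem hAm _))
    (G9.pow_mem hBm _)

/-- An element of `GL₂(𝔽₅)` with entries `(1 0; 0 2)` lies in the half diagonal torus `{diag(1, u)}`.
[cite: Serre1972, §2.1] -/
theorem mem_halfDiagonalSubgroup_of_ofMatrix_eq {g : GL (Fin 2) (ZMod 5)} (hg : Quad.ofMatrix ((g : GL (Fin 2) (ZMod 5)) : Matrix (Fin 2) (Fin 2) (ZMod 5)) = (1, 0, 0, 2)) :
    g ∈ halfDiagonalSubgroup (ZMod 5) := by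
  simp only [Quad.ofMatrix, Prod.mk.injEq] at hg
  obtain ⟨h00, h01, h10, -⟩ := hg
  rw [mem_halfDiagonalSubgroup_iff]
  exact ⟨⟨h01, h10⟩, h00⟩

/-- The four test words as elements of `GL₂(𝔽₅)` (`h` any element with entries `(1 0; 0 2)`). [folklore] -/
theorem exists_wordGL (H : Subgroup (GL (Fin 2) (ZMod 5))) {x h : GL (Fin 2) (ZMod 5)} (hx : x ∈ H) (hh : h ∈ H)
    (hhq : Quad.ofMatrix ((h : GL (Fin 2) (ZMod 5)) : Matrix (Fin 2) (Fin 2) (ZMod 5)) = (1, 0, 0, 2)) (i : Fin 4) :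
    ∃ w ∈ H, Quad.ofMatrix ((w : GL (Fin 2) (ZMod 5)) : Matrix (Fin 2) (Fin 2) (ZMod 5)) = Quad.word (Quad.ofMatrix (x : Matrix (Fin 2) (Fin 2) (ZMod 5))) i := by
  fin_cases i
  · exact ⟨x * x, H.mul_mem hx hx, by simp only [Quad.word, Quad.ofMatrix_coe_mul]; rfl⟩
  · exact ⟨x * h * x * h, H.mul_mem (H.mul_mem (H.mul_mem hx hh) hx) hh, by
      simp only [Quad.word, Quad.ofMatrix_coe_mul, hhq]; rfl⟩
  · exact ⟨x * x * h ^ 2, H.mul_mem (H.mul_mem hx hx) (H.pow_mem hh _), by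
      simp only [Quad.word, Quad.ofMatrix_coe_mul, Quad.ofMatrix_coe_pow, hhq]; rfl⟩
  · exact ⟨x * h * x * h ^ 3, H.mul_mem (H.mul_mem (H.mul_mem hx hh) hx) (H.pow_mem hh _), by
      simp only [Quad.word, Quad.ofMatrix_coe_mul, Quad.ofMatrix_coe_pow, hhq]; rfl⟩

/-! ### §4. `5'`-subgroups containing a split half-Cartan subgroup lie in a conjugate of `G₉` -/

/-- **Main lemma, diagonal frame.** A subgroup `H ≤ GL₂(𝔽₅)` of order prime to `5` containing the half
diagonal torus `{diag(1, u) : u ∈ 𝔽₅ˣ}` is contained in Zywina's `G₉`: an element `x ∈ H` outside `G₉`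
would give, by the order-`5` certificate, a word `w ∈ H` with `w⁴` of order `5`. [folklore] -/
theorem le_G9_of_halfDiagonalSubgroup_le {H : Subgroup (GL (Fin 2) (ZMod 5))} (h5 : ¬ 5 ∣ Nat.card H)
    (hT : halfDiagonalSubgroup (ZMod 5) ≤ H) : H ≤ G9 := by
  intro x hx
  obtain ⟨-, h, -, -, -, -, hhq, -, -⟩ := exists_generators
  have hh : h ∈ H := hT (mem_halfDiagonalSubgroup_of_ofMatrix_eq hhq)
  cases hin : Quad.inG9 (Quad.ofMatrix (x : Matrix (Fin 2) (Fin 2) (ZMod 5)))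
  swap
  · exact mem_G9_of_inG9 x hin
  exfalso
  obtain ⟨i, hcert⟩ := Quad.cert_of_not_inG9' _ (det_ofMatrix_ne_zero x) hin
  obtain ⟨h4, h20⟩ := (Quad.cert_iff _).mp hcert
  obtain ⟨w, hwmem, hofw⟩ := exists_wordGL H hx hh hhq i
  have hv1 : w ^ 4 ≠ 1 := by
    intro h1
    apply h4
    rw [← hofw, ← Quad.ofMatrix_coe_pow, h1, Units.val_one]
    exact Quad.ofMatrix_one
  have hv5 : (w ^ 4) ^ 5 = 1 := by
    apply eq_of_ofMatrix_eq
    rw [← pow_mul, Quad.ofMatrix_coe_pow, hofw, Units.val_one, Quad.ofMatrix_one]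
    exact h20
  have hord : orderOf (⟨w ^ 4, H.pow_mem hwmem 4⟩ : H) = 5 := by
    rw [Subgroup.orderOf_mk]
    exact orderOf_eq_prime hv5 hv1
  have hdvd := orderOf_dvd_natCard (⟨w ^ 4, H.pow_mem hwmem 4⟩ : H)
  rw [hord] at hdvd
  exact h5 hdvd

/-- **Main lemma.** A subgroup `H ≤ GL₂(𝔽₅)` of order prime to `5` containing a split half-Cartan
subgroup `P (1 0; 0 *) P⁻¹` (Serre 1972 §2.1 a)) is contained in the conjugate `P G₉ P⁻¹` of Zywina's
`G₉` (conjugate back by `P`, apply the diagonal-frame lemma). In particular `N_s(5) ≤ G₉` up to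
conjugacy, as printed ("the unique maximal subgroup of `GL₂(𝔽₅)` which contains `N_s(5)`").
[cite: Zywina2015, §1.3 (definition of G₉)] [cite: Serre1972, §2.1] -/
theorem le_map_G9_of_halfSplitCartan_le {H : Subgroup (GL (Fin 2) (ZMod 5))} (h5 : ¬ 5 ∣ Nat.card H) {P : GL (Fin 2) (ZMod 5)}
    (hT : halfSplitCartan P ≤ H) : H ≤ G9.map (MulAut.conj P).toMonoidHom := by
  let f : GL (Fin 2) (ZMod 5) →* GL (Fin 2) (ZMod 5) := (MulAut.conj P⁻¹).toMonoidHom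
  have hf : Function.Injective f := fun a b hab => (MulAut.conj P⁻¹).injective hab
  let H' : Subgroup (GL (Fin 2) (ZMod 5)) := H.map f
  have hcard : Nat.card H' = Nat.card H := Subgroup.card_map_of_injective hf
  have hT' : halfDiagonalSubgroup (ZMod 5) ≤ H' := by
    intro d hd
    have hPd : (MulAut.conj P).toMonoidHom d ∈ H := hT ⟨d, hd, rfl⟩
    refine ⟨(MulAut.conj P).toMonoidHom d, hPd, ?_⟩
    change P⁻¹ * (P * d * P⁻¹) * P⁻¹⁻¹ = d
    group
  have h5' : ¬ 5 ∣ Nat.card H' := by rw [hcard]; exact h5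
  have hle : H' ≤ G9 := le_G9_of_halfDiagonalSubgroup_le h5' hT'
  intro x hx
  have hx' : f x ∈ H' := ⟨x, hx, rfl⟩
  refine ⟨f x, hle hx', ?_⟩
  change P * (P⁻¹ * x * P⁻¹⁻¹) * P⁻¹ = x
  group

end Field

end Summit.BirchSwinnertonDyer.BirchSwinnertonDyer.Theorems.ZywinaG9

end
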